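import Summits.CriticalPhenomena.PercolationContinuityZ3.Theorems.PercNearOneGluingNoHeavyLowerTailObserverExchangeTools
import HarnessLib

/-!
# `NoHeavyLowerTail` (stmt-CriticalPhenomena-4575) — the two-relay MONOTONE-COVARIANCE lemma ("base Mono")
# (depth prover `nh-dp-commonrelay`, gen 7)

Support file (`--supports stmt-CriticalPhenomena-4575`); no definitions, no named facts, no sorries.

**Base Mono (PROVED here).**  For bond percolation `μ = prodBernoulli w` on the complete weighted graph `Fin n`,
relays `a₁ ≠ a₂`, an observer `o` and a target `b`, with `J = {a₁ ↔ a₂}`, `O = {a₁ ↔ o}`, `O₂ = {a₂ ↔ o}`,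
`U = {a₁ ↔ b}`:
  `μ(Jᶜ ∩ O₂) · (μ(J ∩ U) − μ(J) μ(U)) ≤ μ(Jᶜ) · (μ(O ∩ U) − μ(O) μ(U))`,
i.e. `Cov(1{o ∈ C(a₁)}, 1{b ∈ C(a₁)}) ≥ φ · Cov(1{a₂ ∈ C(a₁)}, 1{b ∈ C(a₁)})` with `φ = μ(a₂ ↔ o | a₁ ↮ a₂)`:
the observer's attachment to `a₁` co-varies with `b`'s attachment at least `φ` times as strongly as the second relay's
attachment does.  With `U = J` it is the two-relay form of Kozma–Nitzan's Lemma 2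
(`μ(o↔a₁ | a₁↔a₂) ≥ μ(o↔a₁ | a₁↮a₂) + μ(o↔a₂ | a₁↮a₂)`); the covariance form is, as far as we searched, not in print
(presearch: corpus "conditional correlation inequalities percolation clusters" → vdBK 2001 / BHK 2006 only; galaxy none).

PROOF ("Harris + BHK once each").  `1_O = 1_E − 1_F` with `E = O ∪ O₂ = {o ∈ C(a₁) ∪ C(a₂)}` (increasing) and
`F = Jᶜ ∩ O₂` (disjoint from `O`).  Harris: `μ(E ∩ U) ≥ μ(E) μ(U)`.  BHK Thm 1.4 (clusters of `a₂` and `a₁` given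
`a₁ ↮ a₂`, tree form `obs_bhkCross`): `μ(Jᶜ) μ(Jᶜ ∩ O₂ ∩ U) ≤ μ(Jᶜ ∩ O₂) μ(Jᶜ ∩ U)`.  The rest is bookkeeping
(`bm_arith`).

ROLE.  This is the `T`-frozen ("within-world") engine of the hypothesis-free covariance comparisons (K\*g), (K\*t)
registered on the item (`stub_covCompThreeRelaysG/T`, assembly `…CovComp.lean`): conditionally on the cluster `T = C(a₃)`
(`a₁ ∉ T`) the configuration off `T` is percolation on `G ∖ T`, where the present lemma applies verbatim; what remains
of (K\*g)/(K\*t) is the mixed ("between-worlds") term — memo RESIDUAL-gen7.md §7.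
-/

namespace Summit.CriticalPhenomena.PercolationContinuityZ3.Theorems

open MeasureTheory Set Literature.Probability.LatticeModels Literature.Probability.Percolation

noncomputable section

open Classical

variable {n : ℕ}

/-- `E = O ∪ O₂` splits as `O ⊔ (Jᶜ ∩ O₂)`: if `o ↔ a₂` but `o ↮ a₁` then `a₁ ↮ a₂`. [folklore] -/
theorem bm_set_E (a₁ a₂ o : Fin n) :
    ((openConn a₁ o ∪ openConn a₂ o) : Set (BondConfig (Fin n))) =
      openConn a₁ o ∪ ((openConn a₁ a₂)ᶜ ∩ openConn a₂ o) := by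
  ext ω
  simp only [mem_union, mem_inter_iff, mem_compl_iff, knThm2_mem_openConn]
  constructor
  · rintro (h | h)
    · exact Or.inl h
    · by_cases h1 : (openGraph ω).Reachable a₁ o
      · exact Or.inl h1
      · exact Or.inr ⟨fun h12 => h1 (h12.trans h), h⟩
  · rintro (h | ⟨_, h⟩)
    · exact Or.inl h
    · exact Or.inr h

/-- `O` and `F = Jᶜ ∩ O₂` are disjoint: `a₁ ↔ o ↔ a₂` forces `a₁ ↔ a₂`. [folklore] -/
theorem bm_disjoint_OF (a₁ a₂ o : Fin n) (X : Set (BondConfig (Fin n))) :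
    Disjoint ((openConn a₁ o : Set (BondConfig (Fin n))) ∩ X) ((openConn a₁ a₂)ᶜ ∩ openConn a₂ o ∩ X) := by
  rw [Set.disjoint_left]
  rintro ω ⟨h, _⟩ ⟨⟨h12, h2⟩, _⟩
  rw [mem_compl_iff, knThm2_mem_openConn] at h12
  exact h12 ((show (openGraph ω).Reachable a₁ o from h).trans (show (openGraph ω).Reachable a₂ o from h2).symm)

/-- `μ(E ∩ X) = μ(O ∩ X) + μ(F ∩ X)` for any event `X`. [folklore] -/
theorem bm_E_split (w : Sym2 (Fin n) → unitInterval) (a₁ a₂ o : Fin n) (X : Set (BondConfig (Fin n))) :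
    (prodBernoulli w).real ((openConn a₁ o ∪ openConn a₂ o) ∩ X) =
      (prodBernoulli w).real (openConn a₁ o ∩ X) + (prodBernoulli w).real ((openConn a₁ a₂)ᶜ ∩ openConn a₂ o ∩ X) := by
  rw [bm_set_E, Set.union_inter_distrib_right]
  exact measureReal_union (bm_disjoint_OF a₁ a₂ o X) MeasurableSet.of_discrete

/-- The BHK world `{S ↮ S'}` for `S = {a₂}`, `S' = {a₁}` is `Jᶜ = {a₁ ↮ a₂}`. [folklore] -/
theorem bm_sep_set (a₁ a₂ : Fin n) :
    {ω : BondConfig (Fin n) | ∀ s ∈ ({a₂} : Finset (Fin n)), ∀ x ∈ ({a₁} : Finset (Fin n)),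
        ¬ (openGraph ω).Reachable s x} = (openConn a₁ a₂)ᶜ := by
  ext ω
  simp only [Finset.mem_singleton, forall_eq, mem_setOf_eq, mem_compl_iff, knThm2_mem_openConn]
  exact ⟨fun h h' => h h'.symm, fun h h' => h h'.symm⟩

/-- Bookkeeping for base Mono: from Harris (`hH`), BHK (`hB`) and the splittings. [folklore] -/
theorem bm_arith {d dU dF dFU u oU o_ eU e : ℝ} (hd : 0 ≤ d)
    (heU : eU = oU + dFU) (he : e = o_ + dF)
    (hH : e * u ≤ eU) (hB : d * dFU ≤ dF * dU) :
    dF * ((u - dU) - (1 - d) * u) ≤ d * (oU - o_ * u) := by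
  have h1 := mul_le_mul_of_nonneg_left hH hd
  have key : d * (oU - o_ * u) - dF * ((u - dU) - (1 - d) * u) = (d * eU - d * (e * u)) + (dF * dU - d * dFU) := by
    rw [heU, he]; ring
  nlinarith [key, h1, hB]

/-- **Base Mono (two relays, PROVED): `μ(Jᶜ ∩ {a₂↔o}) · Cov(J, U) ≤ μ(Jᶜ) · Cov(O, U)`** for `J = {a₁↔a₂}`,
`O = {a₁↔o}`, `U = {a₁↔b}`, division-free (`Cov(A, B) = μ(A ∩ B) − μ(A) μ(B)`).  Harris for
`E = {a₁↔o} ∪ {a₂↔o}` against `U`, and BHK Thm 1.4 for `{a₂↔o}` against `{a₁↔b}` on `{a₁ ↮ a₂}`.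
[cite: VandenbergHaggstromKahn2005, Thm. 1.4 (p. 7); KozmaNitzan2024, Lemma 2 (p. 6)] -/
theorem baseMono_twoRelays (w : Sym2 (Fin n) → unitInterval) (a₁ a₂ o b : Fin n) (h12 : a₁ ≠ a₂) :
    (prodBernoulli w).real ((openConn a₁ a₂)ᶜ ∩ openConn a₂ o) *
        ((prodBernoulli w).real (openConn a₁ a₂ ∩ openConn a₁ b) -
          (prodBernoulli w).real (openConn a₁ a₂ : Set (BondConfig (Fin n))) *
            (prodBernoulli w).real (openConn a₁ b : Set (BondConfig (Fin n)))) ≤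
      (prodBernoulli w).real ((openConn a₁ a₂)ᶜ : Set (BondConfig (Fin n))) *
        ((prodBernoulli w).real (openConn a₁ o ∩ openConn a₁ b) -
          (prodBernoulli w).real (openConn a₁ o : Set (BondConfig (Fin n))) *
            (prodBernoulli w).real (openConn a₁ b : Set (BondConfig (Fin n)))) := by
  -- Harris for `E = O ∪ O₂` and `U`
  have hH := prodBernoulli_harris w (A := (openConn a₁ o ∪ openConn a₂ o : Set (BondConfig (Fin n))))
    (B := (openConn a₁ b : Set (BondConfig (Fin n))))
    ((isUpperSet_openConn a₁ o).union (isUpperSet_openConn a₂ o)) (isUpperSet_openConn a₁ b)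
    MeasurableSet.of_discrete MeasurableSet.of_discrete
  -- BHK Thm 1.4 on `{a₁ ↮ a₂}`: `{a₂ ↔ o}` versus `{a₁ ↔ b}`
  have hdis : Disjoint ({a₂} : Finset (Fin n)) {a₁} := by
    rw [Finset.disjoint_singleton_left, Finset.mem_singleton]
    exact fun h => h12 h.symm
  have hB := obs_bhkCross w {a₂} {a₁} o (x := a₁) (Finset.mem_singleton_self a₁) b hdis
  rw [bm_sep_set, Finset.set_biUnion_singleton] at hB
  -- splittings
  have heU := bm_E_split w a₁ a₂ o (openConn a₁ b)
  have he := bm_E_split w a₁ a₂ o Set.univ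
  simp only [Set.inter_univ] at he
  have hJ : (prodBernoulli w).real (openConn a₁ a₂ : Set (BondConfig (Fin n))) =
      1 - (prodBernoulli w).real ((openConn a₁ a₂)ᶜ : Set (BondConfig (Fin n))) := by
    rw [measureReal_compl MeasurableSet.of_discrete, probReal_univ]; ring
  have hJU : (prodBernoulli w).real (openConn a₁ a₂ ∩ openConn a₁ b : Set (BondConfig (Fin n))) =
      (prodBernoulli w).real (openConn a₁ b : Set (BondConfig (Fin n))) -
        (prodBernoulli w).real ((openConn a₁ a₂)ᶜ ∩ openConn a₁ b : Set (BondConfig (Fin n))) := by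
    have h := measureReal_inter_add_sdiff (μ := prodBernoulli w) (s := (openConn a₁ b : Set (BondConfig (Fin n))))
      (t := openConn a₁ a₂) MeasurableSet.of_discrete
    rw [Set.sdiff_eq, Set.inter_comm (openConn a₁ b : Set (BondConfig (Fin n))) (openConn a₁ a₂),
      Set.inter_comm (openConn a₁ b : Set (BondConfig (Fin n))) (openConn a₁ a₂)ᶜ] at h
    linarith
  rw [hJ, hJU]
  have e1 : ((openConn a₁ a₂)ᶜ ∩ (openConn a₂ o ∩ openConn a₁ b) : Set (BondConfig (Fin n))) =
      (openConn a₁ a₂)ᶜ ∩ openConn a₂ o ∩ openConn a₁ b := by rw [Set.inter_assoc]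
  rw [e1] at hB
  exact bm_arith measureReal_nonneg heU he hH hB

end

end Summit.CriticalPhenomena.PercolationContinuityZ3.Theorems
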